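import Summits.AtomisticToContinuum.Crystallization.Theorems.FreeSplittingCertificatesStrictSplittingRuleCoreFirstOrderDesignGeometry

/-!
# `StrictSplittingRule` (stmt-AtomisticToContinuum-12560), line `birth`, stub `stub_coreFirstOrderDesign` (H1):
# II. the line truss of the relaxed hcp crystal

Helper file (no item closed).  The first-order design routes the radial load `W′(‖x‖²) x` of the site at
relative position `x = V c d` (`c` the parity of the receiver, `d` the index difference; `V true d = y_d`,
`V false d = −y_{−d}`, `y = hcpSite a h`) along the four Bravais index lines through it: the frame component
`λ_s ⟪x, y_s⟫ y_s` travels along `d + ℤ s`.  The "definitions" are hypotheses (`hV`, `hF`, `hτ`) on function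
variables, instantiated by `rfl` in the final file:
* `F c s d n = W′(‖V c (d + n•s)‖²)⟪V c (d + n•s), y_s⟫`, the load line — summable and SUMMING TO ZERO
  (`h1_line_sum`: antisymmetric about the foot of the perpendicular from the root by half-integrality);
* `τ c s d`, the tension of the directed stencil bond `d → d + s`: the outgoing tail `Σ_{m ≥ 1} F_m` if the bond
  points away from the root, else (the same number) minus the incoming part `−Σ_{m ≤ 0} F_m`;
* `h1_tau_rec` (node equilibrium `τ(d − s) − τ(d) = F c s d 0`) and `h1_tau_bound`
  (`|τ c s d| ≤ K(a,h) (1 + ‖V c d‖)⁻⁶`: tails of `r⁻⁷` loads on the far side of the node, `h1_master`).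
All `[folklore]` (statics of a one-dimensional truss; cf. FrieseckeTheil2002, HudsonOrtner2011).
-/
noncomputable section

namespace Summit.AtomisticToContinuum.Crystallization.Theorems.StrictSplittingRuleBirth

open scoped BigOperators
open Literature.MathematicalPhysics.StatisticalMechanics
open Summit.AtomisticToContinuum.Crystallization.Theorems.PalmUnimodularRigidity.LayeredLawsSelectHcp

/-! ## §1 The outgoing tail of a load line -/

/-- **The outgoing tail of a load line.**  For `‖v‖, ‖e‖ ≥ ρ₀ > 0` and `⟪v, e⟫ ≥ 0` the loads at `v + (m+1) e`,
`m ≥ 0`, are absolutely summable with `Σ_m |W′(‖·‖²)⟪·, e⟫| ≤ (8/3)·C_W·‖v‖⁻⁶`, `C_W = ½(1 + ρ₀⁻⁶)` (`|W′| ≤ C_W σ⁻⁴`,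
`‖v + t e‖² ≥ ‖v‖² + t²‖e‖² ≥ (‖v‖ + t‖e‖)²/2`, telescoping `Σ (‖v‖ + (m+1)‖e‖)⁻⁷ ≤ ‖v‖⁻⁶/(6‖e‖)`). [folklore] -/
theorem h1_master {ρ₀ : ℝ} (hρ : 0 < ρ₀) {v e : EuclideanSpace ℝ (Fin 3)} (hv : ρ₀ ≤ ‖v‖) (he : ρ₀ ≤ ‖e‖)
    (hve : 0 ≤ inner ℝ v e) :
    (Summable fun m : ℕ => ljSqDeriv (‖v + ((m : ℝ) + 1) • e‖ ^ 2) * inner ℝ (v + ((m : ℝ) + 1) • e) e) ∧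
      ∑' m : ℕ, |ljSqDeriv (‖v + ((m : ℝ) + 1) • e‖ ^ 2) * inner ℝ (v + ((m : ℝ) + 1) • e) e| ≤
        8 / 3 * (1 / 2 * (1 + ((ρ₀ ^ 2)⁻¹) ^ 3)) * (‖v‖⁻¹) ^ 6 := by
  set C : ℝ := 1 / 2 * (1 + ((ρ₀ ^ 2)⁻¹) ^ 3) with hC
  have hC0 : 0 ≤ C := by positivity
  have hvpos : 0 < ‖v‖ := hρ.trans_le hv
  have hepos : 0 < ‖e‖ := hρ.trans_le he
  have hpt : ∀ m : ℕ, |ljSqDeriv (‖v + ((m : ℝ) + 1) • e‖ ^ 2) * inner ℝ (v + ((m : ℝ) + 1) • e) e| ≤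
      16 * C * ‖e‖ * ((‖v‖ + ((m : ℝ) + 1) * ‖e‖)⁻¹) ^ 7 := by
    intro m
    have ht : (0 : ℝ) < (m : ℝ) + 1 := by positivity
    have hsq : ‖v‖ ^ 2 + ((m : ℝ) + 1) ^ 2 * ‖e‖ ^ 2 ≤ ‖v + ((m : ℝ) + 1) • e‖ ^ 2 := by
      rw [norm_add_sq_real, real_inner_smul_right, norm_smul, Real.norm_eq_abs, abs_of_pos ht]
      nlinarith [hve]
    have hρv : ρ₀ ^ 2 ≤ ‖v‖ ^ 2 := pow_le_pow_left₀ hρ.le hv 2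
    have hσ₀ : ρ₀ ^ 2 ≤ ‖v + ((m : ℝ) + 1) • e‖ ^ 2 := hρv.trans (le_trans (by nlinarith) hsq)
    have hW := h1_abs_ljSqDeriv_le (by positivity : (0 : ℝ) < ρ₀ ^ 2) hσ₀
    have hin : |inner ℝ (v + ((m : ℝ) + 1) • e) e| ≤ ‖v + ((m : ℝ) + 1) • e‖ * ‖e‖ :=
      abs_real_inner_le_norm _ _
    set S : ℝ := ‖v‖ + ((m : ℝ) + 1) * ‖e‖ with hS
    have hSpos : 0 < S := by positivity
    have hwle : ‖v + ((m : ℝ) + 1) • e‖ ≤ S := by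
      calc ‖v + ((m : ℝ) + 1) • e‖ ≤ ‖v‖ + ‖((m : ℝ) + 1) • e‖ := norm_add_le _ _
        _ = S := by rw [norm_smul, Real.norm_eq_abs, abs_of_pos ht]
    have hw2 : S ^ 2 / 2 ≤ ‖v + ((m : ℝ) + 1) • e‖ ^ 2 := by
      refine le_trans ?_ hsq
      rw [hS]
      nlinarith [sq_nonneg (‖v‖ - ((m : ℝ) + 1) * ‖e‖)]
    have hinv1 : (‖v + ((m : ℝ) + 1) • e‖ ^ 2)⁻¹ ≤ 2 * (S⁻¹) ^ 2 := by
      calc (‖v + ((m : ℝ) + 1) • e‖ ^ 2)⁻¹ ≤ (S ^ 2 / 2)⁻¹ := inv_anti₀ (by positivity) hw2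
        _ = 2 * (S⁻¹) ^ 2 := by rw [inv_div, inv_pow]; ring
    have hinv : ((‖v + ((m : ℝ) + 1) • e‖ ^ 2)⁻¹) ^ 4 ≤ 16 * (S⁻¹) ^ 8 := by
      calc ((‖v + ((m : ℝ) + 1) • e‖ ^ 2)⁻¹) ^ 4 ≤ (2 * (S⁻¹) ^ 2) ^ 4 :=
            pow_le_pow_left₀ (by positivity) hinv1 4
        _ = 16 * (S⁻¹) ^ 8 := by ring
    calc |ljSqDeriv (‖v + ((m : ℝ) + 1) • e‖ ^ 2) * inner ℝ (v + ((m : ℝ) + 1) • e) e|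
        = |ljSqDeriv (‖v + ((m : ℝ) + 1) • e‖ ^ 2)| * |inner ℝ (v + ((m : ℝ) + 1) • e) e| := abs_mul _ _
      _ ≤ (C * ((‖v + ((m : ℝ) + 1) • e‖ ^ 2)⁻¹) ^ 4) * (‖v + ((m : ℝ) + 1) • e‖ * ‖e‖) :=
          mul_le_mul hW hin (abs_nonneg _) (by positivity)
      _ ≤ (C * (16 * (S⁻¹) ^ 8)) * (S * ‖e‖) := by gcongr
      _ = 16 * C * ‖e‖ * (S⁻¹) ^ 7 := by field_simp
  obtain ⟨hts, htb⟩ := h1_tail_bound hvpos hepos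
  have hdom : Summable fun m : ℕ => 16 * C * ‖e‖ * ((‖v‖ + ((m : ℝ) + 1) * ‖e‖)⁻¹) ^ 7 := hts.mul_left _
  have hsum : Summable fun m : ℕ =>
      ljSqDeriv (‖v + ((m : ℝ) + 1) • e‖ ^ 2) * inner ℝ (v + ((m : ℝ) + 1) • e) e :=
    Summable.of_norm_bounded hdom fun m => by rw [Real.norm_eq_abs]; exact hpt m
  refine ⟨hsum, ?_⟩
  calc ∑' m : ℕ, |ljSqDeriv (‖v + ((m : ℝ) + 1) • e‖ ^ 2) * inner ℝ (v + ((m : ℝ) + 1) • e) e|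
      ≤ ∑' m : ℕ, 16 * C * ‖e‖ * ((‖v‖ + ((m : ℝ) + 1) * ‖e‖)⁻¹) ^ 7 :=
        Summable.tsum_le_tsum hpt hsum.abs hdom
    _ = 16 * C * ‖e‖ * ∑' m : ℕ, ((‖v‖ + ((m : ℝ) + 1) * ‖e‖)⁻¹) ^ 7 := tsum_mul_left
    _ ≤ 16 * C * ‖e‖ * ((‖v‖⁻¹) ^ 6 / (6 * ‖e‖)) := by gcongr
    _ = 8 / 3 * C * (‖v‖⁻¹) ^ 6 := by field_simp; ring

/-! ## §2 Bond vectors seen from either sublattice -/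

section Bond

variable {a h : ℝ} {V : Bool → ℤ × ℤ × ℤ → EuclideanSpace ℝ (Fin 3)}

/-- From an even-layer site the bond vector of index difference `d` is `y_d`. [folklore] -/
theorem h1_V_true (hV : ∀ c d, V c d = if c = true then hcpSite a h d else -hcpSite a h (-d)) (d : ℤ × ℤ × ℤ) :
    V true d = hcpSite a h d := by simp [hV]

/-- From an odd-layer site it is `−y_{−d}`. [folklore] -/
theorem h1_V_false (hV : ∀ c d, V c d = if c = true then hcpSite a h d else -hcpSite a h (-d)) (d : ℤ × ℤ × ℤ) :
    V false d = -hcpSite a h (-d) := by simp [hV]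

/-- `V c 0 = 0`. [folklore] -/
theorem h1_V_zero (hV : ∀ c d, V c d = if c = true then hcpSite a h d else -hcpSite a h (-d)) (c : Bool) :
    V c 0 = 0 := by cases c <;> simp [hV, hcpSite_zero]

/-- **Bond lines**: `V c (d + n•s) = V c d + n • y_s` for an even-layer direction `s`. [folklore] -/
theorem h1_V_line (hV : ∀ c d, V c d = if c = true then hcpSite a h d else -hcpSite a h (-d)) (c : Bool)
    {s : ℤ × ℤ × ℤ} (hs : Even s.1) (d : ℤ × ℤ × ℤ) (n : ℤ) :
    V c (d + n • s) = V c d + (n : ℝ) • hcpSite a h s := by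
  cases c
  · have e1 : -(d + n • s) = -d + (-n) • s := by rw [neg_add, neg_smul]
    rw [h1_V_false hV, h1_V_false hV, e1, h1_line a h hs (-d) (-n)]
    push_cast
    rw [neg_smul, neg_add, neg_neg]
  · rw [h1_V_true hV, h1_V_true hV, h1_line a h hs]

/-- Non-degeneracy: `‖V c d‖ ≥ min a h` for `d ≠ 0` (`a, h > 0`). [folklore] -/
theorem h1_V_norm_ge (ha : 0 < a) (hh : 0 < h)
    (hV : ∀ c d, V c d = if c = true then hcpSite a h d else -hcpSite a h (-d)) (c : Bool) {d : ℤ × ℤ × ℤ}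
    (hd : d ≠ 0) : min a h ≤ ‖V c d‖ := by
  cases c
  · rw [h1_V_false hV, norm_neg]; exact h1_norm_ge ha hh (neg_ne_zero.2 hd)
  · rw [h1_V_true hV]; exact h1_norm_ge ha hh hd

/-- Half-integrality of `⟪V c d, y_s⟫ / (‖y_s‖²/2)` for a stencil direction `s`. [folklore] -/
theorem h1_V_halfInt (hV : ∀ c d, V c d = if c = true then hcpSite a h d else -hcpSite a h (-d)) (c : Bool)
    {s : ℤ × ℤ × ℤ} (hs : s ∈ ({(0, 1, 0), (0, 0, 1), (0, -1, 1), (2, 0, 0)} : Finset (ℤ × ℤ × ℤ)))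
    (d : ℤ × ℤ × ℤ) :
    ∃ N : ℤ, inner ℝ (V c d) (hcpSite a h s) = ‖hcpSite a h s‖ ^ 2 / 2 * N := by
  cases c
  · obtain ⟨N, hN⟩ := h1_inner_halfInt a h hs (-d)
    refine ⟨-N, ?_⟩
    rw [h1_V_false hV, inner_neg_left, hN]
    push_cast
    ring
  · obtain ⟨N, hN⟩ := h1_inner_halfInt a h hs d
    exact ⟨N, by rw [h1_V_true hV, hN]⟩

/-- **The flip**: the bond `p → q` read from `q` is minus the bond read from `p` (index form). [folklore] -/
theorem h1_V_flip (hV : ∀ c d, V c d = if c = true then hcpSite a h d else -hcpSite a h (-d)) (b : Bool)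
    (d : ℤ × ℤ × ℤ) : V (if Even d.1 then b else !b) (-d) = -V b d := by
  by_cases hd : Even d.1
  · simp only [hd, if_true]
    cases b
    · rw [h1_V_false hV, h1_V_false hV, neg_neg, neg_neg, h1_neg_of_even a h hd]
    · rw [h1_V_true hV, h1_V_true hV, h1_neg_of_even a h hd]
  · simp only [hd, if_false]
    cases b
    · simp [h1_V_true hV, h1_V_false hV]
    · simp [h1_V_true hV, h1_V_false hV]

/-- `Σ_d (1 + ‖V c d‖)⁻ⁿ < ∞` for `n > 3`. [folklore] -/
theorem h1_V_summable (ha : 0 < a) (hh : 0 < h)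
    (hV : ∀ c d, V c d = if c = true then hcpSite a h d else -hcpSite a h (-d)) (c : Bool) {n : ℕ}
    (hn : 3 < n) : Summable fun d : ℤ × ℤ × ℤ => ((1 + ‖V c d‖)⁻¹) ^ n := by
  cases c
  · simp_rw [h1_V_false hV, norm_neg]
    exact (h1_summable_one_add_inv_pow ha hh hn).comp_injective neg_injective
  · simp_rw [h1_V_true hV]
    exact h1_summable_one_add_inv_pow ha hh hn

end Bond

/-! ## §3 The load lines of the crystal -/

section Lines

variable {a h : ℝ} {V : Bool → ℤ × ℤ × ℤ → EuclideanSpace ℝ (Fin 3)} {F : Bool → (ℤ × ℤ × ℤ) → (ℤ × ℤ × ℤ) → ℤ → ℝ}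

/-- **Every load line of the crystal is summable and sums to zero.**  `F c s d n = W′(‖x_n‖²)⟪x_n, y_s⟫`,
`x_n = V c (d + n•s)`, is the radial load at the `n`-th point of the index line through `d` in the stencil
direction `s`, read along the line; the line is antisymmetric about the foot of the perpendicular from the root
(`h1_T_antisymm` with the half-integrality `h1_V_halfInt`), and summable (outgoing tails in both directions,
`h1_master`, from bases `d ± M s` beyond the foot). [folklore] -/
theorem h1_line_sum (ha : 0 < a) (hh : 0 < h)
    (hV : ∀ c d, V c d = if c = true then hcpSite a h d else -hcpSite a h (-d))
    (hF : ∀ c s d n, F c s d n =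
      ljSqDeriv (‖V c (d + n • s)‖ ^ 2) * inner ℝ (V c (d + n • s)) (hcpSite a h s))
    (c : Bool) {s : ℤ × ℤ × ℤ} (hs : s ∈ ({(0, 1, 0), (0, 0, 1), (0, -1, 1), (2, 0, 0)} : Finset (ℤ × ℤ × ℤ)))
    (d : ℤ × ℤ × ℤ) :
    Summable (F c s d) ∧ ∑' n : ℤ, F c s d n = 0 := by
  have hFd : F c s d = fun n => ljSqDeriv (‖V c (d + n • s)‖ ^ 2) * inner ℝ (V c (d + n • s)) (hcpSite a h s) :=
    funext (hF c s d)
  set e := hcpSite a h s with he_def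
  have hse := h1_stencil_even hs
  have hline : ∀ n : ℤ, V c (d + n • s) = V c d + (n : ℝ) • e := h1_V_line hV c hse d
  obtain ⟨N, hN⟩ := h1_V_halfInt hV c hs d
  have hρ : 0 < min a h := lt_min ha hh
  have hs0 : s ≠ 0 := by rintro rfl; exact absurd hs (by decide)
  have he : min a h ≤ ‖e‖ := h1_norm_ge ha hh hs0
  have hanti : ∀ n : ℤ, F c s d (-N - n) = -F c s d n := fun n => by
    rw [hF, hF, hline, hline]; exact h1_T_antisymm _ _ hN n
  refine ⟨?_, h1_tsum_eq_zero_of_antisymm N hanti⟩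
  -- bases `d ± M s` beyond the foot of the perpendicular, from which the line is outgoing
  set M : ℕ := N.natAbs + 1 with hM
  have hMR : (M : ℝ) = |(N : ℝ)| + 1 := by rw [hM]; push_cast; rw [Nat.cast_natAbs]; push_cast; ring
  have hM₁ : (0 : ℝ) < N + 2 * M := by rw [hMR]; nlinarith [abs_nonneg (N : ℝ), neg_abs_le (N : ℝ)]
  have hM₂ : (0 : ℝ) < -N + 2 * M := by rw [hMR]; nlinarith [abs_nonneg (N : ℝ), le_abs_self (N : ℝ)]
  have hnz : ∀ (k : ℤ) (x : EuclideanSpace ℝ (Fin 3)), 0 < inner ℝ (V c (d + k • s)) x → min a h ≤ ‖V c (d + k • s)‖ :=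
    fun k x hk => h1_V_norm_ge ha hh hV c fun h0 => by rw [h0, h1_V_zero hV] at hk; simp at hk
  have hin₁ : inner ℝ (V c (d + (M : ℤ) • s)) e = ‖e‖ ^ 2 / 2 * (N + 2 * M) := by
    rw [hline, inner_add_left, real_inner_smul_left, real_inner_self_eq_norm_sq, hN]; push_cast; ring
  have hin₂ : inner ℝ (V c (d + (-(M : ℤ)) • s)) (-e) = ‖e‖ ^ 2 / 2 * (-N + 2 * M) := by
    rw [hline, inner_neg_right, inner_add_left, real_inner_smul_left, real_inner_self_eq_norm_sq, hN]
    push_cast; ring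
  have hepos : 0 < ‖e‖ := hρ.trans_le he
  have hp₁ : 0 < inner ℝ (V c (d + (M : ℤ) • s)) e := by
    rw [hin₁]; exact mul_pos (div_pos (pow_pos hepos 2) two_pos) hM₁
  have hp₂ : 0 < inner ℝ (V c (d + (-(M : ℤ)) • s)) (-e) := by
    rw [hin₂]; exact mul_pos (div_pos (pow_pos hepos 2) two_pos) hM₂
  obtain ⟨hS₁, -⟩ := h1_master hρ (hnz _ _ hp₁) he hp₁.le
  obtain ⟨hS₂, -⟩ := h1_master hρ (hnz _ _ hp₂) (by rwa [norm_neg]) hp₂.le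
  refine h1_summable_int_of_tails (M + 1) (hS₁.congr fun m => ?_) (hS₂.neg.congr fun m => ?_)
  · have e1 : V c d + ((M : ℤ) : ℝ) • e + ((m : ℝ) + 1) • e = V c d + (((m : ℤ) + (M + 1 : ℕ) : ℤ) : ℝ) • e := by
      push_cast; module
    rw [hF, hline, hline, e1]
  · have e2 : V c d + ((-(M : ℤ) : ℤ) : ℝ) • e + ((m : ℝ) + 1) • -e =
        V c d + ((-((m : ℤ) + (M + 1 : ℕ)) : ℤ) : ℝ) • e := by
      push_cast; module
    rw [hF, hline, hline, e2, inner_neg_right]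
    ring

end Lines

/-! ## §4 The line tensions: recursion and decay -/

section Tension

variable {a h : ℝ} {V : Bool → ℤ × ℤ × ℤ → EuclideanSpace ℝ (Fin 3)} {F : Bool → (ℤ × ℤ × ℤ) → (ℤ × ℤ × ℤ) → ℤ → ℝ}
  {τ : Bool → (ℤ × ℤ × ℤ) → (ℤ × ℤ × ℤ) → ℝ}

/-- **The tension recursion** (node equilibrium along the line): the tension `τ c s d` of the directed stencil
bond `d → d + s` — the outgoing tail `Σ_{m ≥ 1} F_m` of its load line beyond `d`, or equivalently (zero line sum)
minus the incoming part `−Σ_{m ≤ 0} F_m` — drops by exactly the load at `d` across the node `d`: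
`τ(d − s) − τ(d) = F c s d 0 = W′(‖V c d‖²)⟪V c d, y_s⟫`. [folklore] -/
theorem h1_tau_rec (ha : 0 < a) (hh : 0 < h)
    (hV : ∀ c d, V c d = if c = true then hcpSite a h d else -hcpSite a h (-d))
    (hF : ∀ c s d n, F c s d n =
      ljSqDeriv (‖V c (d + n • s)‖ ^ 2) * inner ℝ (V c (d + n • s)) (hcpSite a h s))
    (hτ : ∀ c s d, τ c s d = if 0 ≤ inner ℝ (V c d) (hcpSite a h s) then ∑' m : ℕ, F c s d ((m : ℤ) + 1)
      else -(F c s d 0 + ∑' m : ℕ, F c s d (-((m : ℤ) + 1))))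
    (c : Bool) {s : ℤ × ℤ × ℤ} (hs : s ∈ ({(0, 1, 0), (0, 0, 1), (0, -1, 1), (2, 0, 0)} : Finset (ℤ × ℤ × ℤ)))
    (d : ℤ × ℤ × ℤ) : τ c s (d - s) - τ c s d = F c s d 0 := by
  have hse := h1_stencil_even hs
  have hidx : ∀ n : ℤ, d - s + n • s = d + (n - 1) • s := fun n => by rw [sub_smul, one_smul]; abel
  have hFs : ∀ n : ℤ, F c s (d - s) n = F c s d (n - 1) := fun n => by rw [hF, hF, hidx]
  have hin : inner ℝ (V c (d - s)) (hcpSite a h s) = inner ℝ (V c d) (hcpSite a h s) - ‖hcpSite a h s‖ ^ 2 := by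
    rw [show d - s = d + (-1 : ℤ) • s by rw [neg_one_smul, sub_eq_add_neg], h1_V_line hV c hse,
      inner_add_left, real_inner_smul_left, real_inner_self_eq_norm_sq]
    push_cast; ring
  obtain ⟨hsum, hzero⟩ := h1_line_sum ha hh hV hF c hs d
  obtain ⟨hS0, hS1, hS2, hsplit⟩ := h1_line_tails hsum
  have e0 := hS0.tsum_eq_zero_add
  have e2 := hS2.tsum_eq_zero_add
  push_cast at e0 e2
  have e2' : ∑' m : ℕ, F c s d (-((m : ℤ) + 1) - 1) = ∑' m : ℕ, F c s d (-((m : ℤ) + 1 + 1)) :=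
    tsum_congr fun m => by ring_nf
  have hesq : 0 ≤ ‖hcpSite a h s‖ ^ 2 := sq_nonneg _
  rw [hτ c s (d - s), hτ c s d]
  simp only [hFs, hin, add_sub_cancel_right, zero_sub, e2']
  split_ifs with h1 h2 h2
  · linarith
  · exfalso; linarith
  · linarith
  · linarith

/-- Length of a stencil vector: `a` or `2h`, so `‖y_s‖ ≤ a + 2h`. [folklore] -/
theorem h1_stencil_norm_le (ha : 0 < a) (hh : 0 < h) {s : ℤ × ℤ × ℤ}
    (hs : s ∈ ({(0, 1, 0), (0, 0, 1), (0, -1, 1), (2, 0, 0)} : Finset (ℤ × ℤ × ℤ))) : ‖hcpSite a h s‖ ≤ a + 2 * h := by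
  have hsq := h1_stencil_norm_sq a h hs
  split_ifs at hsq with h0
  · rw [(pow_left_inj₀ (norm_nonneg _) ha.le two_ne_zero).1 hsq]; linarith
  · rw [(pow_left_inj₀ (norm_nonneg _) (by positivity) two_ne_zero).1 (by rw [hsq]; ring : ‖hcpSite a h s‖ ^ 2 = (2 * h) ^ 2)]
    linarith

/-- **Decay of the line tensions**: `|τ c s d| ≤ K (1 + ‖V c d‖)⁻⁶` with
`K = C_W ((8/3 + (a+2h)/ρ₀)(1 + ρ₀⁻¹)⁶ + (11/3) ρ₀⁻⁶)`, `ρ₀ = min a h`, `C_W = ½(1 + ρ₀⁻⁶)`: the defining tail is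
always taken on the side of the node AWAY from the root, where `‖V c d + t y_s‖² ≥ ‖V c d‖² + t²‖y_s‖²`
(`h1_master`); the incoming form costs one extra load `|F 0| ≤ C_W ‖y_s‖ ‖V c d‖⁻⁷`. [folklore] -/
theorem h1_tau_bound (ha : 0 < a) (hh : 0 < h)
    (hV : ∀ c d, V c d = if c = true then hcpSite a h d else -hcpSite a h (-d))
    (hF : ∀ c s d n, F c s d n =
      ljSqDeriv (‖V c (d + n • s)‖ ^ 2) * inner ℝ (V c (d + n • s)) (hcpSite a h s))
    (hτ : ∀ c s d, τ c s d = if 0 ≤ inner ℝ (V c d) (hcpSite a h s) then ∑' m : ℕ, F c s d ((m : ℤ) + 1)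
      else -(F c s d 0 + ∑' m : ℕ, F c s d (-((m : ℤ) + 1))))
    (c : Bool) {s : ℤ × ℤ × ℤ} (hs : s ∈ ({(0, 1, 0), (0, 0, 1), (0, -1, 1), (2, 0, 0)} : Finset (ℤ × ℤ × ℤ)))
    (d : ℤ × ℤ × ℤ) :
    |τ c s d| ≤ 1 / 2 * (1 + (((min a h) ^ 2)⁻¹) ^ 3) *
      ((8 / 3 + (a + 2 * h) * (min a h)⁻¹) * (1 + (min a h)⁻¹) ^ 6 + 11 / 3 * ((min a h)⁻¹) ^ 6) *
        ((1 + ‖V c d‖)⁻¹) ^ 6 := by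
  set ρ₀ := min a h with hρ₀
  set CW : ℝ := 1 / 2 * (1 + ((ρ₀ ^ 2)⁻¹) ^ 3) with hCW
  set e := hcpSite a h s with he_def
  set v := V c d with hv_def
  have hρ : 0 < ρ₀ := lt_min ha hh
  have hs0 : s ≠ 0 := by rintro rfl; exact absurd hs (by decide)
  have he : ρ₀ ≤ ‖e‖ := h1_norm_ge ha hh hs0
  have hepos : 0 < ‖e‖ := hρ.trans_le he
  have heab : ‖e‖ ≤ a + 2 * h := h1_stencil_norm_le ha hh hs
  have hCW0 : 0 ≤ CW := by positivity
  have hline : ∀ n : ℤ, V c (d + n • s) = v + (n : ℝ) • e := h1_V_line hV c (h1_stencil_even hs) d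
  have hFn : ∀ n : ℤ, F c s d n = ljSqDeriv (‖v + (n : ℝ) • e‖ ^ 2) * inner ℝ (v + (n : ℝ) • e) e := fun n => by
    rw [hF, hline]
  have hP : 0 ≤ (1 + ρ₀⁻¹) ^ 6 := by positivity
  have hA : 0 ≤ (a + 2 * h) * ρ₀⁻¹ := by positivity
  have hB : 0 ≤ 11 / 3 * (ρ₀⁻¹) ^ 6 := by positivity
  have hX : 0 ≤ ((1 + ‖v‖)⁻¹) ^ 6 := by positivity
  -- the sum splits
  obtain ⟨-, hS1, hS2, -⟩ := h1_line_tails (h1_line_sum ha hh hV hF c hs d).1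
  rw [hτ]
  split_ifs with hsg
  · by_cases hd : d = 0
    · -- the line through the root, read from the root: `v = 0`
      have hv0 : v = 0 := by rw [hv_def, hd, h1_V_zero hV]
      obtain ⟨hSm, hBm⟩ := h1_master hρ he he (real_inner_self_nonneg (x := e))
      have split := hS1.tsum_eq_zero_add
      push_cast at split
      have htail : ∑' m : ℕ, F c s d ((m : ℤ) + 1 + 1) =
          ∑' m : ℕ, ljSqDeriv (‖e + ((m : ℝ) + 1) • e‖ ^ 2) * inner ℝ (e + ((m : ℝ) + 1) • e) e :=
        tsum_congr fun m => by
          rw [hFn, hv0, zero_add]; push_cast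
          rw [show ((m : ℝ) + 1 + 1) • e = e + ((m : ℝ) + 1) • e by module]
      have h0 : |F c s d 1| ≤ CW * (‖e‖⁻¹) ^ 6 := by
        rw [hFn, hv0, zero_add]; push_cast; rw [one_smul]
        calc |ljSqDeriv (‖e‖ ^ 2) * inner ℝ e e| ≤ CW * ‖e‖ * (‖e‖⁻¹) ^ 7 := h1_T_abs_le hρ he e
          _ = CW * (‖e‖⁻¹) ^ 6 := by field_simp
      have hinv : (‖e‖⁻¹) ^ 6 ≤ (ρ₀⁻¹) ^ 6 := pow_le_pow_left₀ (by positivity) (inv_anti₀ hρ he) 6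
      have hX1 : ((1 + ‖v‖)⁻¹) ^ 6 = 1 := by rw [hv0, norm_zero, add_zero, inv_one, one_pow]
      rw [split, htail, hX1, mul_one]
      calc |F c s d 1 + ∑' m : ℕ, ljSqDeriv (‖e + ((m : ℝ) + 1) • e‖ ^ 2) * inner ℝ (e + ((m : ℝ) + 1) • e) e|
          ≤ |F c s d 1| + |∑' m : ℕ, ljSqDeriv (‖e + ((m : ℝ) + 1) • e‖ ^ 2) * inner ℝ (e + ((m : ℝ) + 1) • e) e| :=
            abs_add_le _ _
        _ ≤ CW * (‖e‖⁻¹) ^ 6 + 8 / 3 * CW * (‖e‖⁻¹) ^ 6 := add_le_add h0 ((h1_abs_tsum_le hSm).trans hBm)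
        _ = CW * (11 / 3 * (‖e‖⁻¹) ^ 6) := by ring
        _ ≤ CW * (11 / 3 * (ρ₀⁻¹) ^ 6) := by gcongr
        _ ≤ CW * ((8 / 3 + (a + 2 * h) * ρ₀⁻¹) * (1 + ρ₀⁻¹) ^ 6 + 11 / 3 * (ρ₀⁻¹) ^ 6) := by
            gcongr; nlinarith [mul_nonneg hA hP]
    · -- outgoing, away from the root
      have hvρ : ρ₀ ≤ ‖v‖ := h1_V_norm_ge ha hh hV c hd
      obtain ⟨hSm, hBm⟩ := h1_master hρ hvρ he hsg
      have htail : ∑' m : ℕ, F c s d ((m : ℤ) + 1) =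
          ∑' m : ℕ, ljSqDeriv (‖v + ((m : ℝ) + 1) • e‖ ^ 2) * inner ℝ (v + ((m : ℝ) + 1) • e) e :=
        tsum_congr fun m => by rw [hFn]; push_cast; rfl
      rw [htail]
      calc |∑' m : ℕ, ljSqDeriv (‖v + ((m : ℝ) + 1) • e‖ ^ 2) * inner ℝ (v + ((m : ℝ) + 1) • e) e|
          ≤ 8 / 3 * CW * (‖v‖⁻¹) ^ 6 := (h1_abs_tsum_le hSm).trans hBm
        _ ≤ 8 / 3 * CW * ((1 + ρ₀⁻¹) ^ 6 * ((1 + ‖v‖)⁻¹) ^ 6) := by gcongr; exact h1_inv_pow_le_one_add hρ hvρ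
        _ = CW * (8 / 3 * (1 + ρ₀⁻¹) ^ 6) * ((1 + ‖v‖)⁻¹) ^ 6 := by ring
        _ ≤ CW * ((8 / 3 + (a + 2 * h) * ρ₀⁻¹) * (1 + ρ₀⁻¹) ^ 6 + 11 / 3 * (ρ₀⁻¹) ^ 6) *
              ((1 + ‖v‖)⁻¹) ^ 6 := by
            gcongr; nlinarith [mul_nonneg hA hP]
  · -- incoming form: `⟪v, e⟫ < 0`, so `d ≠ 0`
    have hlt : inner ℝ v e < 0 := lt_of_not_ge hsg
    have hd : d ≠ 0 := fun hd => by rw [hv_def, hd, h1_V_zero hV, inner_zero_left] at hlt; exact lt_irrefl _ hlt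
    have hvρ : ρ₀ ≤ ‖v‖ := h1_V_norm_ge ha hh hV c hd
    have hvpos : 0 < ‖v‖ := hρ.trans_le hvρ
    obtain ⟨hSm, hBm⟩ := h1_master hρ hvρ (by rwa [norm_neg] : ρ₀ ≤ ‖-e‖)
      (by rw [inner_neg_right]; linarith : 0 ≤ inner ℝ v (-e))
    have htail : ∑' m : ℕ, F c s d (-((m : ℤ) + 1)) =
        ∑' m : ℕ, -(ljSqDeriv (‖v + ((m : ℝ) + 1) • -e‖ ^ 2) * inner ℝ (v + ((m : ℝ) + 1) • -e) (-e)) :=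
      tsum_congr fun m => by
        rw [hFn, inner_neg_right]; push_cast
        rw [show (-((m : ℝ) + 1)) • e = ((m : ℝ) + 1) • -e by module]; ring
    have h0 : |F c s d 0| ≤ CW * ((a + 2 * h) * ρ₀⁻¹) * (‖v‖⁻¹) ^ 6 := by
      rw [hFn]; push_cast; rw [zero_smul, add_zero]
      calc |ljSqDeriv (‖v‖ ^ 2) * inner ℝ v e| ≤ CW * ‖e‖ * (‖v‖⁻¹) ^ 7 := h1_T_abs_le hρ hvρ e
        _ = CW * (‖e‖ * ‖v‖⁻¹) * (‖v‖⁻¹) ^ 6 := by ring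
        _ ≤ CW * ((a + 2 * h) * ρ₀⁻¹) * (‖v‖⁻¹) ^ 6 := by
            gcongr
    rw [abs_neg, htail, tsum_neg]
    calc |F c s d 0 + -∑' m : ℕ, ljSqDeriv (‖v + ((m : ℝ) + 1) • -e‖ ^ 2) * inner ℝ (v + ((m : ℝ) + 1) • -e) (-e)|
        ≤ |F c s d 0| + |-∑' m : ℕ, ljSqDeriv (‖v + ((m : ℝ) + 1) • -e‖ ^ 2) * inner ℝ (v + ((m : ℝ) + 1) • -e) (-e)| :=
          abs_add_le _ _
      _ ≤ CW * ((a + 2 * h) * ρ₀⁻¹) * (‖v‖⁻¹) ^ 6 + 8 / 3 * CW * (‖v‖⁻¹) ^ 6 := by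
          rw [abs_neg]; exact add_le_add h0 ((h1_abs_tsum_le hSm).trans hBm)
      _ = CW * (8 / 3 + (a + 2 * h) * ρ₀⁻¹) * (‖v‖⁻¹) ^ 6 := by ring
      _ ≤ CW * (8 / 3 + (a + 2 * h) * ρ₀⁻¹) * ((1 + ρ₀⁻¹) ^ 6 * ((1 + ‖v‖)⁻¹) ^ 6) := by
          gcongr; exact h1_inv_pow_le_one_add hρ hvρ
      _ = CW * ((8 / 3 + (a + 2 * h) * ρ₀⁻¹) * (1 + ρ₀⁻¹) ^ 6) * ((1 + ‖v‖)⁻¹) ^ 6 := by ring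
      _ ≤ CW * ((8 / 3 + (a + 2 * h) * ρ₀⁻¹) * (1 + ρ₀⁻¹) ^ 6 + 11 / 3 * (ρ₀⁻¹) ^ 6) *
            ((1 + ‖v‖)⁻¹) ^ 6 := by gcongr; linarith

end Tension

/-! ## Registered anchor of this file -/

/-- **Registered anchor `stub_coreFirstOrderDesignTruss`** (helper file II of the H1 design `stub_coreFirstOrderDesign`;
expire once that stub lands): the stencil vectors have length at most `a + 2h`. [folklore] -/
theorem stub_coreFirstOrderDesignTruss :
    ∀ a h : ℝ, 0 < a → 0 < h → ∀ s ∈ ({(0, 1, 0), (0, 0, 1), (0, -1, 1), (2, 0, 0)} : Finset (ℤ × ℤ × ℤ)),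
      ‖hcpSite a h s‖ ≤ a + 2 * h :=
  fun _ _ ha hh _ hs => h1_stencil_norm_le ha hh hs

end Summit.AtomisticToContinuum.Crystallization.Theorems.StrictSplittingRuleBirth

end
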